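import Summits.ResolutionOfSingularities.ResolutionOfSingularities.Theorems.FrobeniusClosingPatchingRelPerfectDepthMultiHostResidualBare
import Literature.AlgebraicGeometry.Resolution.MarkedIdealsHomogenized
import HarnessLib

/-!
# Crux `PatchingRelPerfect` (stmt-ResolutionOfSingularities-16161), chain W5.2 — F7(β) (β-AX) X3 C-I (n1): the STALK CALCULUS of
# `MultiHostState.step` / `MultiHostState.residual` at a point

[OURS · L1 W5.2 · res-L1-w52-plan-1 RULING G12-13 (2) (n1), hand res-L1-w52-stub-2 g6] Design-independent bookkeeping consumed by
every wording of the Phase C-I pole clauses (member hit (M0), monomial move (M1), LEMMA M (M2), LEMMA V (n4)): what the RESIDUAL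
ideal `K♭ = S.residual.K` of a multi-host state looks like in a stalk, and how its exponent lists change under ONE generic step
`S.step τ W η m ν` (blowing up the irreducible regular centre `W`, host orders `m`, weight `ν`, new member `F = τ⁻¹W`).  PROVED:

* §1 `stalkIdeal_K` / `stalkIdeal_residual_K` — `K♭_x = ⨆ᵢ (host i)_x · ∏_{(T,r) ∈ residualExps i} T_x^r`; `residualSummand_stalk_le_of_mem`
  — a summand with a positive residual exponent on a member `T` lies in `T_x`; `residual_stalk_le_of_exponentHits` — the
  EXPONENT-LEVEL hit («every summand keeps a member factor through `x`», res-L1-repro-3 (M1) `hhit`) implies the stalk-level member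
  hit of (M0) (`…DepthPhaseCReachMemberHit`, p560362);
* §2 the EXPONENT BOOKKEEPING of the step in residual currency (over res-L1-w52-stub-1's `…DepthMultiHostResidualBare`, p555039:
  `length_exps`, `step_expAt_of_lt` / `step_expAt_length`): `step_minExpAt_of_lt` / `step_minExpAt_length` (old member-wise minima
  unchanged, the new member's minimum is `μ_F = ⨅ᵢ e_i`, `e_i = m i + weightAt (exps i) η − ν`), and **`step_residualExps`**:
  `(S.step …).residualExps i = (S.residualExps i).map strict ++ [(F, e_i − μ_F)]`;
* §3 **`stalkIdeal_step_residual_K`** — at every point `x′` of `X′`: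
  `K♭′_{x′} = ⨆ᵢ (τᶜ(host i, m i))_{x′} · (∏_{(T,r) ∈ residualExps i} T′_{x′}^r) · F_{x′}^{e_i − μ_F}`.

Pure bookkeeping (lists, suprema, stalks of products); any schemes; fact-free; nothing here is a statement of the manuscript under
review (AI-written; AI review weaker than expert review).

## References

* J. Kollár, *Lectures on Resolution of Singularities* (2007), (3.111) Steps 1–3, Def. 3.25. [Kollar2007]
* E. Bierstone, D. Grigoriev, P. Milman, J. Włodarczyk, arXiv:1206.3090, Def. 3.1.3, §4 Step 2b. [BierstoneGrigorievMilmanWlodarczyk2011]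
-/

-- `Summit.<Summit>.<Sub>.Theorems` with `Sub = Summit` (single-conjunct summit, D-0017)
set_option linter.dupNamespace false

noncomputable section

open CategoryTheory AlgebraicGeometry TopologicalSpace
open Literature.AlgebraicGeometry.Resolution
open Scheme.IdealSheafData

namespace Summit.ResolutionOfSingularities.ResolutionOfSingularities.Theorems.DepthMultiHost

universe u

variable {X X' : Scheme.{u}}

/-! ## §0 List bookkeeping -/

section Lists

/-- `mapIdx` only depends on the function below the length of the list. [folklore] -/
theorem mapIdx_congr_lt {α β : Type*} (l : List α) (f g : ℕ → α → β) (h : ∀ j < l.length, ∀ a, f j a = g j a) :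
    l.mapIdx f = l.mapIdx g := by
  induction l generalizing f g with
  | nil => simp
  | cons a l ih =>
    rw [List.mapIdx_cons, List.mapIdx_cons, h 0 (by simp) a,
      ih (fun i => f (i + 1)) (fun i => g (i + 1)) fun j hj b => h (j + 1) (by simpa using hj) b]

/-- Changing the first components commutes with position-wise re-exponentiation. [folklore] -/
theorem mapIdx_map_pair {α β : Type*} (l : List (α × ℕ)) (g : α → β) (h : ℕ → ℕ → ℕ) :
    ((l.map fun p => (g p.1, p.2)).mapIdx fun j p => (p.1, h j p.2)) =
      (l.mapIdx fun j p => (p.1, h j p.2)).map fun p => (g p.1, p.2) := by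
  induction l generalizing h with
  | nil => simp
  | cons p l ih =>
    rw [List.map_cons, List.mapIdx_cons, List.mapIdx_cons, List.map_cons, ih fun i => h (i + 1)]

end Lists

namespace MultiHostState

variable (S : MultiHostState X)

/-! ## §1 Stalks of `K` and of the residual `K♭` -/

/-- **Stalk of `K`**: `K_x = ⨆ᵢ (host i)_x · (monomialIdeal (exps i))_x`. [cite: BierstoneGrigorievMilmanWlodarczyk2011, Def. 3.1.3] -/
theorem stalkIdeal_K (x : X) :
    stalkIdeal S.K x = ⨆ i : Fin S.n, stalkIdeal (S.host i) x * stalkIdeal (monomialIdeal (S.exps i)) x := by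
  unfold K
  rw [stalkIdeal_iSup]
  exact iSup_congr fun i => stalkIdeal_mul _ _ x

/-- **Stalk of the residual `K♭`**: `K♭_x = ⨆ᵢ (host i)_x · ∏_{(T,r) ∈ residualExps i} T_x^r` (same hosts, residual exponents).
[cite: Kollar2007, (3.111) Step 3] -/
theorem stalkIdeal_residual_K (x : X) :
    stalkIdeal S.residual.K x =
      ⨆ i : Fin S.n, stalkIdeal (S.host i) x * ((S.residualExps i).map fun p => stalkIdeal p.1 x ^ p.2).prod := by
  rw [stalkIdeal_K]
  refine iSup_congr fun i => ?_
  rw [residual_host, residual_exps, stalkIdeal_monomialIdeal]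

/-- A member of a residual exponent list is a member of the state's family. [folklore] -/
theorem fst_mem_𝓔_of_mem_residualExps {i : Fin S.n} {p : X.IdealSheafData × ℕ} (hp : p ∈ S.residualExps i) : p.1 ∈ S.𝓔 := by
  rw [← S.boundaryOf_residualExps i]
  exact fst_mem_boundaryOf hp

/-- **A positive residual exponent is a member factor**: if `(T, r) ∈ residualExps i` with `r ≠ 0`, the residual summand `i` lies in
`T_x` at every point. [folklore] -/
theorem residualSummand_stalk_le_of_mem (x : X) (i : Fin S.n) {p : X.IdealSheafData × ℕ} (hp : p ∈ S.residualExps i)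
    (hp0 : p.2 ≠ 0) :
    stalkIdeal (S.host i) x * ((S.residualExps i).map fun q => stalkIdeal q.1 x ^ q.2).prod ≤ stalkIdeal p.1 x := by
  refine Ideal.mul_le_left.trans ?_
  have h : stalkIdeal p.1 x ^ p.2 ∣ ((S.residualExps i).map fun q => stalkIdeal q.1 x ^ q.2).prod :=
    List.dvd_prod (List.mem_map.mpr ⟨p, hp, rfl⟩)
  exact (Ideal.le_of_dvd h).trans (Ideal.pow_le_self hp0)

/-- **Exponent-level hits give the stalk-level member hit** (the (M1) hypothesis implies the (M0) conclusion): if at `x` every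
summand whose residual part is not the unit stalk keeps a positive residual exponent on a member through `x`, then
`K♭_x ≤ ⨆_{T ∈ 𝓔, x ∈ Supp T} T_x`. [folklore] -/
theorem residual_stalk_le_of_exponentHits (x : X)
    (h : ∀ i : Fin S.n,
      stalkIdeal (S.host i) x * ((S.residualExps i).map fun q => stalkIdeal q.1 x ^ q.2).prod = ⊥ ∨
        ∃ p ∈ S.residualExps i, p.2 ≠ 0 ∧ x ∈ (p.1.support : Set X)) :
    stalkIdeal S.residual.K x ≤
      ⨆ (T : X.IdealSheafData) (_ : T ∈ S.𝓔 ∧ x ∈ (T.support : Set X)), stalkIdeal T x := by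
  rw [stalkIdeal_residual_K]
  refine iSup_le fun i => ?_
  rcases h i with h0 | ⟨p, hp, hp0, hx⟩
  · rw [h0]; exact bot_le
  · exact (S.residualSummand_stalk_le_of_mem x i hp hp0).trans
      (le_iSup₂ (f := fun (T : X.IdealSheafData) (_ : T ∈ S.𝓔 ∧ x ∈ (T.support : Set X)) => stalkIdeal T x)
        p.1 ⟨S.fst_mem_𝓔_of_mem_residualExps hp, hx⟩)

/-! ## §2 Exponent bookkeeping of the generic step -/

section Step

variable [IsLocallyNoetherian X] (τ : X' ⟶ X) (W : Closeds X) (η : X) (m : Fin S.n → ℕ) (ν : ℕ)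
  (hsnc : HasSNCWith S.𝓔 (vanishingIdeal W)) (hτ : IsBlowup τ (vanishingIdeal W))

/-- **Old member-wise minima are unchanged.** [cite: BierstoneGrigorievMilmanWlodarczyk2011, §4 Step 2b] -/
theorem step_minExpAt_of_lt {j : ℕ} (hj : j < S.𝓔.length) :
    (S.step τ W η m ν hsnc hτ).minExpAt j = S.minExpAt j := by
  unfold minExpAt
  exact iInf_congr fun i => S.step_expAt_of_lt τ W η m ν hsnc hτ i hj

/-- **The new member's minimum** `μ_F = ⨅ᵢ e_i`. [cite: BierstoneGrigorievMilmanWlodarczyk2011, §4 Step 2b] -/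
theorem step_minExpAt_length :
    (S.step τ W η m ν hsnc hτ).minExpAt S.𝓔.length = ⨅ i : Fin S.n, (m i + weightAt (S.exps i) η - ν) := by
  unfold minExpAt
  exact iInf_congr fun i => S.step_expAt_length τ W η m ν hsnc hτ i

/-- **THE RESIDUAL EXPONENTS OF THE SUCCESSOR**: the old residual exponents on the strict transforms, then the new member with
exponent `e_i − μ_F`. [cite: Kollar2007, (3.111) Step 3] [cite: BierstoneGrigorievMilmanWlodarczyk2011, §4 Step 2b] -/
theorem step_residualExps (i : Fin S.n) :
    (S.step τ W η m ν hsnc hτ).residualExps i =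
      ((S.residualExps i).map fun p => (strictTransformIdeal τ (vanishingIdeal W) p.1, p.2)) ++
        [((vanishingIdeal W).comap τ,
          (m i + weightAt (S.exps i) η - ν) - ⨅ i : Fin S.n, (m i + weightAt (S.exps i) η - ν))] := by
  unfold residualExps
  rw [step_exps, List.mapIdx_append, List.mapIdx_cons, List.mapIdx_nil, List.length_map, S.length_exps i, zero_add,
    step_minExpAt_length]
  congr 1
  rw [mapIdx_congr_lt _ _ (fun j p => (p.1, p.2 - S.minExpAt j)) (fun j hj p => by
      rw [List.length_map, S.length_exps i] at hj
      rw [S.step_minExpAt_of_lt τ W η m ν hsnc hτ hj])]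
  exact mapIdx_map_pair _ _ fun j n => n - S.minExpAt j

/-- **The residual of the successor, summand by summand.** [cite: Kollar2007, (3.111) Step 3] -/
theorem step_residual_K :
    (S.step τ W η m ν hsnc hτ).residual.K =
      ⨆ i : Fin S.n, controlledTransform τ (vanishingIdeal W) (S.host i) (m i) *
        (monomialIdeal ((S.residualExps i).map fun p => (strictTransformIdeal τ (vanishingIdeal W) p.1, p.2)) *
          (vanishingIdeal W).comap τ ^
            ((m i + weightAt (S.exps i) η - ν) - ⨅ i : Fin S.n, (m i + weightAt (S.exps i) η - ν))) := by
  change (⨆ i : Fin S.n, (S.step τ W η m ν hsnc hτ).host i * monomialIdeal ((S.step τ W η m ν hsnc hτ).residualExps i)) = _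
  refine iSup_congr fun i => ?_
  rw [step_host, step_residualExps, monomialIdeal_append, monomialIdeal_singleton]

/-! ## §3 The stalk of the successor's residual at a point -/

/-- **STALK CALCULUS OF THE STEP**: at every point `x′` of `X′`,
`K♭′_{x′} = ⨆ᵢ (τᶜ(host i, m i))_{x′} · (∏_{(T,r) ∈ residualExps i} (T′)_{x′}^r) · F_{x′}^{e_i − μ_F}`, `F = τ⁻¹W`,
`e_i = m i + weightAt (exps i) η − ν`, `μ_F = ⨅ᵢ e_i`. [cite: Kollar2007, (3.111) Step 3] [cite: BierstoneGrigorievMilmanWlodarczyk2011, §4 Step 2b] -/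
theorem stalkIdeal_step_residual_K (x' : X') :
    stalkIdeal (S.step τ W η m ν hsnc hτ).residual.K x' =
      ⨆ i : Fin S.n, stalkIdeal (controlledTransform τ (vanishingIdeal W) (S.host i) (m i)) x' *
        ((((S.residualExps i).map fun p => stalkIdeal (strictTransformIdeal τ (vanishingIdeal W) p.1) x' ^ p.2).prod) *
          stalkIdeal ((vanishingIdeal W).comap τ) x' ^
            ((m i + weightAt (S.exps i) η - ν) - ⨅ i : Fin S.n, (m i + weightAt (S.exps i) η - ν))) := by
  rw [step_residual_K, stalkIdeal_iSup]
  refine iSup_congr fun i => ?_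
  rw [stalkIdeal_mul, stalkIdeal_mul, stalkIdeal_pow, stalkIdeal_monomialIdeal, List.map_map]
  rfl

/-- **Off the new member the new exponent is invisible**: at `x′ ∉ F` the last factor is the unit stalk. [folklore] -/
theorem stalkIdeal_step_residual_K_of_not_mem (x' : X') (hx' : x' ∉ (((vanishingIdeal W).comap τ).support : Set X')) :
    stalkIdeal (S.step τ W η m ν hsnc hτ).residual.K x' =
      ⨆ i : Fin S.n, stalkIdeal (controlledTransform τ (vanishingIdeal W) (S.host i) (m i)) x' *
        ((S.residualExps i).map fun p => stalkIdeal (strictTransformIdeal τ (vanishingIdeal W) p.1) x' ^ p.2).prod := by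
  rw [stalkIdeal_step_residual_K]
  refine iSup_congr fun i => ?_
  rw [stalkIdeal_eq_top_of_not_mem_support hx', Ideal.top_pow, Ideal.mul_top]

end Step

end MultiHostState

end Summit.ResolutionOfSingularities.ResolutionOfSingularities.Theorems.DepthMultiHost

end
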